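import Literature.Computability.QuantumComplexity.PPPostBQPBlocks
import Literature.Computability.QuantumComplexity.CWrapPost
import Literature.Computability.Complexity.StringCopy
import Literature.Computability.Complexity.FPStringBricks
import Literature.Computability.Complexity.ListFoldBricks
import HarnessLib

/-!
# `PP ⊆ PostBQP`, IV: the counting function of the quantum core is polynomial time

Topic `Literature/Computability/QuantumComplexity`; fourth file of the series proving Aaronson's
`PP ⊆ PostBQP` (Proc. R. Soc. A 461 (2005), Thm. 4; plan in `PPPostBQPScales.lean`). The quantum
core of the construction (file V) is Aaronson's "first prepare the state
`2^{-n/2} Σ_x |x⟩|f(x)⟩`" with `f` replaced by the vector of block predicates of file III: on the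
data wires it holds the input `x` (`n` bits), the sign coins `s₀ … s_{K-1}` (`K = m + 2`,
`m = p(n)`) and the bodies of the `K` blocks (`B = 2m + 5` coins each), followed by the format
suffix `vg n = 1 0 1^{2n}` of `CWrapLayout.lean`; a garbage-free reversible block
(`RevUncompute.lean`) computes from this word the `K` bits
`qbits R p x 0 (signs) (bodies)` (`PPPostBQPBlocks.lean`). This file supplies that word function as
a **total string function `phiF R p` in `FP`**, written in the tree's algebra of `FP` bricks
(`BrickAlgebra.lean`, `PlumbingBricks.lean`, `FPStringBricks.lean`, parsing of the suffix as in
`CWrapPost.lean`), together with its defining equation on well-formed words (`phiF_apply`):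

* `anyTrueF g` — the one-bit test "`g z` contains a `1`" (`notFn (isNilFn ∘ norm ∘ g)`), which
  also reads single bits returned by `bitAtFn` (disjunction and exclusive or are the tree's
  `Brick.orFn`, `HashBricks.xorFn`);
* `baseBitF` / `blockBitF` — the predicates `baseBit`, `blockBit` of files II–III on pair-coded
  arguments (`baseBitF_apply`, `blockBitF_apply`); the decider of `R ∈ P` enters through
  `indicatorFn_mem_FP`;
* `roundF` — one round of the counted loop (`Brick.loopStep`) consuming one sign coin and one body
  and appending one computed bit; `phiF = sndPow 4 ∘ loop ∘ initF`, **`phiF_mem_FP`**, and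
  **`phiF_apply`**: `phiF (x ++ r ++ vg |x|) = qbits R p x 0 (r ↾ K) (r ⇂ K)` when
  `|r| = K + K·B`.

## References

* S. Aaronson, *Quantum computing, postselection, and probabilistic polynomial-time*, Proc. R.
  Soc. A 461 (2005) 3473–3482, arXiv:quant-ph/0412187: Thm. 4 (proof: "an efficiently computable
  Boolean function", "first prepare the state `2^{-n/2} Σ_x |x⟩|f(x)⟩`").
* S. Arora, B. Barak, *Computational Complexity: A Modern Approach*, CUP 2009, §1.3 (closure of
  polynomial time under composition and bounded loops).
-/

noncomputable section

namespace Literature.Computability.QuantumComplexity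

namespace PPPostBQP

open Complexity Complexity.Brick Complexity.Plumb CWrap _root_.Computability

/-! ### One-bit bricks -/

/-- `norm w = []` iff `w` has no `1`. [folklore] -/
theorem norm_eq_nil_iff_any (w : List Bool) : norm w = [] ↔ w.any id = false := by
  rw [norm_eq_nil_iff]
  induction w with
  | nil => simp
  | cons b w ih =>
    rw [bitsToNat_cons, List.any_cons]
    cases b <;> simp [ih]

/-- **"Contains a `1`"** as a one-bit test: `anyTrueF g z = [(g z).any id]`. On a single bit
`[b]` it reads `b`, on `[]` it reads `0`. [folklore] -/
def anyTrueF (g : List Bool → List Bool) : List Bool → List Bool := notFn (isNilFn ∘ norm ∘ g)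

/-- Value of `anyTrueF`. [folklore] -/
@[simp] theorem anyTrueF_apply (g : List Bool → List Bool) (z : List Bool) :
    anyTrueF g z = [(g z).any id] := by
  unfold anyTrueF
  rw [notFn_apply (b := decide (norm (g z) = []))]
  · congr 1
    by_cases h : (g z).any id = true
    · have : ¬ norm (g z) = [] := fun h' => by rw [(norm_eq_nil_iff_any _).1 h'] at h; exact Bool.false_ne_true h
      simp [this, h]
    · have h' : (g z).any id = false := by simpa using h
      simp [(norm_eq_nil_iff_any _).2 h', h']
  · rfl

/-- `anyTrueF g` is one-bit. [folklore] -/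
theorem oneBit_anyTrueF (g : List Bool → List Bool) : OneBit (anyTrueF g) := fun z => ⟨_, anyTrueF_apply g z⟩

/-- `anyTrueF g ∈ FP` for `g ∈ FP`. [folklore] -/
theorem anyTrueF_mem_FP {g : List Bool → List Bool} (hg : g ∈ FP) : anyTrueF g ∈ FP :=
  notFn_mem_FP (comp_mem_FP isNilFn_mem_FP (comp_mem_FP norm_mem_FP hg))

/-- The indicator brick of a language, on a pair-coded argument built by two bricks:
`z ↦ [⟨f z, g z⟩ ∈ R]`. [cite: AroraBarak2009, Def. 1.13] -/
def indPairF (R : Language Bool) (f g : List Bool → List Bool) : List Bool → List Bool :=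
  (fun v => encodeBool (R.boolIndicator v)) ∘ fanoutFn f g

/-- Value of `indPairF`. [folklore] -/
@[simp] theorem indPairF_apply (R : Language Bool) (f g : List Bool → List Bool) (z : List Bool) :
    indPairF R f g z = [R.boolIndicator (boolPair (f z) (g z))] := by
  simp [indPairF, encodeBool]

/-- `indPairF` is one-bit. [folklore] -/
theorem oneBit_indPairF (R : Language Bool) (f g : List Bool → List Bool) : OneBit (indPairF R f g) :=
  fun z => ⟨_, indPairF_apply R f g z⟩

/-- `indPairF R f g ∈ FP` for `R ∈ P`. [cite: AroraBarak2009, Def. 1.13] -/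
theorem indPairF_mem_FP {R : Language Bool} (hR : R ∈ Classes.P) {f g : List Bool → List Bool} (hf : f ∈ FP)
    (hg : g ∈ FP) : indPairF R f g ∈ FP :=
  comp_mem_FP (indicatorFn_mem_FP hR) (fanoutFn_mem_FP hf hg)

/-- A bit read by `bitAtFn` inside the string, then tested. [folklore] -/
theorem any_bitAtFn_boolPair {a b : List Bool} (h : a.length < b.length) :
    (bitAtFn (boolPair a b)).any id = b.getD a.length false := by
  rw [bitAtFn_boolPair_of_lt a b h, List.getD_eq_getElem _ _ h]
  simp

/-- `l.all (¬ ·) = ¬ l.any id`. [folklore] -/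
theorem all_not_eq_not_any (l : List Bool) : l.all (fun b => !b) = !(l.any id) := by
  induction l with
  | nil => rfl
  | cons b l ih => rw [List.all_cons, List.any_cons, ih]; cases b <;> simp

/-! ### The base predicate as a brick -/

section Base

variable (R : Language Bool) (p : Polynomial ℕ)

/-- `yt[m + k]` as a one-bit test, on `⟨x, yt⟩` (`m = p |x|`). [folklore] -/
def ytBitC (k : ℕ) : List Bool → List Bool :=
  anyTrueF (bitAtFn ∘ fanoutFn (polyFn (p + Polynomial.C k) ∘ fstF) sndF)

/-- `y = yt ↾ m`, on `⟨x, yt⟩`. [folklore] -/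
def yPartF : List Bool → List Bool := takeFn ∘ fanoutFn (polyFn p ∘ fstF) sndF

/-- **The base predicate on `⟨x, yt⟩`**: `baseBit R p x yt` (file II) as a composition of bricks.
[cite: Aaronson2005, Thm. 4 (proof)] -/
def baseBitF : List Bool → List Bool :=
  iteFn (ytBitC p 0)
    (orFn (andFn (andFn (notFn (anyTrueF (yPartF p))) (notFn (ytBitC p 1))) (notFn (ytBitC p 2))) (ytBitC p 2))
    (notFn (indPairF R fstF (yPartF p)))

variable {R p}

/-- Value of `ytBitC` on a long enough `yt`. [folklore] -/
theorem ytBitC_apply {k : ℕ} {x yt : List Bool} (h : p.eval x.length + k < yt.length) :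
    ytBitC p k (boolPair x yt) = [yt.getD (p.eval x.length + k) false] := by
  unfold ytBitC
  rw [anyTrueF_apply]
  simp only [Function.comp_apply, fanoutFn_apply, fstF_boolPair, sndF_boolPair, polyFn_apply,
    Polynomial.eval_add, Polynomial.eval_C]
  rw [any_bitAtFn_boolPair (by simpa using h)]
  simp

/-- `ytBitC` is one-bit. [folklore] -/
theorem oneBit_ytBitC (k : ℕ) : OneBit (ytBitC p k) := oneBit_anyTrueF _

/-- Value of `yPartF`. [folklore] -/
theorem yPartF_apply (x yt : List Bool) : yPartF p (boolPair x yt) = yt.take (p.eval x.length) := by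
  simp [yPartF]

/-- **`baseBitF` computes `baseBit`** (on `⟨x, yt⟩` with `|yt| ≥ m + 3`). [cite: Aaronson2005, Thm. 4 (proof)] -/
theorem baseBitF_apply {x yt : List Bool} (h : p.eval x.length + 3 ≤ yt.length) :
    baseBitF R p (boolPair x yt) = [baseBit R p x yt] := by
  have h0 := ytBitC_apply (p := p) (k := 0) (x := x) (yt := yt) (by omega)
  have h1 := ytBitC_apply (p := p) (k := 1) (x := x) (yt := yt) (by omega)
  have h2 := ytBitC_apply (p := p) (k := 2) (x := x) (yt := yt) (by omega)
  have hy : anyTrueF (yPartF p) (boolPair x yt) = [(yt.take (p.eval x.length)).any id] := by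
    rw [anyTrueF_apply, yPartF_apply]
  have hind : indPairF R fstF (yPartF p) (boolPair x yt) =
      [R.boolIndicator (boolPair x (yt.take (p.eval x.length)))] := by
    rw [indPairF_apply, fstF_boolPair, yPartF_apply]
  rw [Nat.add_zero] at h0
  unfold baseBitF baseBit
  rw [iteFn_apply h0]
  split_ifs with hb
  · rw [orFn_apply (andFn_apply (andFn_apply (notFn_apply hy) (notFn_apply h1)) (notFn_apply h2)) h2,
      all_not_eq_not_any]
  · rw [notFn_apply hind]

/-- `baseBitF` is one-bit. [folklore] -/
theorem oneBit_baseBitF : OneBit (baseBitF R p) :=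
  (oneBit_ytBitC 0).ite (oneBit_orFn (oneBit_andFn (oneBit_andFn (oneBit_notFn (oneBit_anyTrueF _))
    (oneBit_notFn (oneBit_ytBitC 1))) (oneBit_notFn (oneBit_ytBitC 2))) (oneBit_ytBitC 2))
    (oneBit_notFn (oneBit_indPairF _ _ _))

/-- `ytBitC p k ∈ FP`. [folklore] -/
theorem ytBitC_mem_FP (k : ℕ) : ytBitC p k ∈ FP :=
  anyTrueF_mem_FP (comp_mem_FP bitAtFn_mem_FP
    (fanoutFn_mem_FP (comp_mem_FP (polyFn_mem_FP _) fstF_mem_FP) sndF_mem_FP))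

/-- `yPartF p ∈ FP`. [folklore] -/
theorem yPartF_mem_FP : yPartF p ∈ FP :=
  comp_mem_FP takeFn_mem_FP (fanoutFn_mem_FP (comp_mem_FP (polyFn_mem_FP _) fstF_mem_FP) sndF_mem_FP)

/-- **`baseBitF ∈ FP` for `R ∈ P`.** [cite: AroraBarak2009, §1.3] -/
theorem baseBitF_mem_FP (hR : R ∈ Classes.P) : baseBitF R p ∈ FP :=
  iteFn_mem_FP (ytBitC_mem_FP 0)
    (orFn_mem_FP (andFn_mem_FP (andFn_mem_FP (notFn_mem_FP (anyTrueF_mem_FP yPartF_mem_FP))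
      (notFn_mem_FP (ytBitC_mem_FP 1))) (notFn_mem_FP (ytBitC_mem_FP 2))) (ytBitC_mem_FP 2))
    (notFn_mem_FP (indPairF_mem_FP hR fstF_mem_FP yPartF_mem_FP))

end Base

/-! ### The block predicate on the loop record -/

section Block

variable (R : Language Bool) (p : Polynomial ℕ)

/-- The body length as a polynomial: `B = 2m + 5`. [folklore] -/
def bodyPoly : Polynomial ℕ := 2 * p + Polynomial.C 5

/-- The loop record is `⟨x, ⟨cnt, ⟨1ⁱ, ⟨signs, ⟨bodies, acc⟩⟩⟩⟩⟩`; the current body is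
`bodies ↾ B`. [folklore] -/
def blkF : List Bool → List Bool := takeFn ∘ fanoutFn (polyFn (bodyPoly p) ∘ nthF 0) (nthF 4)

/-- The current sign coin `[s]` (head of the sign field). [folklore] -/
def sgF : List Bool → List Bool := take1Fn ∘ nthF 3

/-- A bit of the current body at position `m + k`, as a one-bit test. [folklore] -/
def blkBitC (k : ℕ) : List Bool → List Bool :=
  anyTrueF (bitAtFn ∘ fanoutFn (polyFn (p + Polynomial.C k) ∘ nthF 0) (blkF p))

/-- The coin `u` (position `2m + 4` of the body), as a one-bit test. [folklore] -/
def uC : List Bool → List Bool :=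
  anyTrueF (bitAtFn ∘ fanoutFn (polyFn (2 * p + Polynomial.C 4) ∘ nthF 0) (blkF p))

/-- `(body ⇂ (m+3)) ↾ i` — the first `i` coins of `wz`, `i` read off the unary field `1ⁱ`. [folklore] -/
def wzF : List Bool → List Bool :=
  takeFn ∘ fanoutFn (nthF 2) (dropFn ∘ fanoutFn (polyFn (p + Polynomial.C 3) ∘ nthF 0) (blkF p))

/-- `yt = body ↾ (m+3)`. [folklore] -/
def ytF : List Bool → List Bool := takeFn ∘ fanoutFn (polyFn (p + Polynomial.C 3) ∘ nthF 0) (blkF p)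

/-- **The block predicate on the loop record**: `blockBit R p x i s (bodies ↾ B)` as bricks
(`u ? [wz↾i ≠ 0] ∧ b₃ : baseBit ⊕ s`). [cite: Aaronson2005, Thm. 4 (proof: the ratios 2^i)] -/
def blockBitF : List Bool → List Bool :=
  iteFn (uC p) (andFn (anyTrueF (wzF p)) (blkBitC p 2))
    (HashBricks.xorFn (baseBitF R p ∘ fanoutFn (nthF 0) (ytF p)) (anyTrueF sgF))

variable {R p}

/-- `bodyPoly` evaluates to `bodyLen`. [folklore] -/
@[simp] theorem eval_bodyPoly (n : ℕ) : (bodyPoly p).eval n = bodyLen p n := by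
  simp [bodyPoly, bodyLen]; ring

/-- The loop record. [folklore] -/
def rec6 (x cnt iu ss bods acc : List Bool) : List Bool :=
  boolPair x (boolPair cnt (boolPair iu (boolPair ss (boolPair bods acc))))

/-- Fields of the loop record. [folklore] -/
@[simp] theorem nthF_rec6 (x cnt iu ss bods acc : List Bool) :
    nthF 0 (rec6 x cnt iu ss bods acc) = x ∧ nthF 1 (rec6 x cnt iu ss bods acc) = cnt ∧
      nthF 2 (rec6 x cnt iu ss bods acc) = iu ∧ nthF 3 (rec6 x cnt iu ss bods acc) = ss ∧
      nthF 4 (rec6 x cnt iu ss bods acc) = bods ∧ sndPow 4 (rec6 x cnt iu ss bods acc) = acc := by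
  simp [rec6]

/-- Value of `blkF` on the record. [folklore] -/
theorem blkF_rec6 (x cnt iu ss bods acc : List Bool) :
    blkF p (rec6 x cnt iu ss bods acc) = bods.take (bodyLen p x.length) := by
  simp [blkF, rec6]

/-- **`blockBitF` computes `blockBit`** on a record whose body field starts with a full body and
whose sign field starts with `s`. [cite: Aaronson2005, Thm. 4 (proof)] -/
theorem blockBitF_apply (x cnt : List Bool) (i : ℕ) (s : Bool) (ss bods acc : List Bool)
    (hb : bodyLen p x.length ≤ bods.length) :
    blockBitF R p (rec6 x cnt (ones i) (s :: ss) bods acc) =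
      [blockBit R p x i s (bods.take (bodyLen p x.length))] := by
  set blk := bods.take (bodyLen p x.length) with hblk
  have hlen : blk.length = bodyLen p x.length := by rw [hblk, List.length_take]; omega
  have hB : bodyLen p x.length = 2 * p.eval x.length + 5 := by unfold bodyLen; ring
  have hblkF : blkF p (rec6 x cnt (ones i) (s :: ss) bods acc) = blk := blkF_rec6 _ _ _ _ _ _
  have hu : uC p (rec6 x cnt (ones i) (s :: ss) bods acc) = [blk.getD (2 * p.eval x.length + 4) false] := by
    unfold uC; rw [anyTrueF_apply]
    simp only [Function.comp_apply, fanoutFn_apply, hblkF]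
    rw [(nthF_rec6 _ _ _ _ _ _).1, polyFn_apply,
      any_bitAtFn_boolPair (by simp only [List.length_replicate, hlen, hB, Polynomial.eval_add, Polynomial.eval_mul,
        Polynomial.eval_C, Polynomial.eval_ofNat]; omega)]
    simp [Polynomial.eval_add, Polynomial.eval_mul]
  have hb3 : blkBitC p 2 (rec6 x cnt (ones i) (s :: ss) bods acc) = [blk.getD (p.eval x.length + 2) false] := by
    unfold blkBitC; rw [anyTrueF_apply]
    simp only [Function.comp_apply, fanoutFn_apply, hblkF]
    rw [(nthF_rec6 _ _ _ _ _ _).1, polyFn_apply,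
      any_bitAtFn_boolPair (by simp only [List.length_replicate, hlen, hB, Polynomial.eval_add, Polynomial.eval_C]; omega)]
    simp [Polynomial.eval_add]
  have hwz : anyTrueF (wzF p) (rec6 x cnt (ones i) (s :: ss) bods acc) =
      [((blk.drop (p.eval x.length + 3)).take i).any id] := by
    unfold wzF; rw [anyTrueF_apply]
    simp only [Function.comp_apply, fanoutFn_apply, hblkF]
    rw [(nthF_rec6 _ _ _ _ _ _).1, (nthF_rec6 _ _ _ _ _ _).2.2.1, polyFn_apply, dropFn_boolPair, takeFn_boolPair]
    simp [Polynomial.eval_add]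
  have hs : anyTrueF sgF (rec6 x cnt (ones i) (s :: ss) bods acc) = [s] := by
    rw [anyTrueF_apply]; unfold sgF
    simp only [Function.comp_apply]
    rw [(nthF_rec6 _ _ _ _ _ _).2.2.2.1]
    simp [take1Fn]
  have hyt : (baseBitF R p ∘ fanoutFn (nthF 0) (ytF p)) (rec6 x cnt (ones i) (s :: ss) bods acc) =
      [baseBit R p x (blk.take (p.eval x.length + 3))] := by
    simp only [Function.comp_apply, fanoutFn_apply]
    unfold ytF
    simp only [Function.comp_apply, fanoutFn_apply, hblkF]
    rw [(nthF_rec6 _ _ _ _ _ _).1, polyFn_apply, takeFn_boolPair,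
      baseBitF_apply (by simp only [List.length_take, List.length_replicate, hlen, hB, Polynomial.eval_add,
        Polynomial.eval_C]; omega)]
    simp [Polynomial.eval_add]
  unfold blockBitF blockBit
  rw [iteFn_apply hu]
  split_ifs
  · rw [andFn_apply hwz hb3]
  · rw [HashBricks.xorFn_apply hyt hs]

/-- `blockBitF` is one-bit. [folklore] -/
theorem oneBit_blockBitF : OneBit (blockBitF R p) :=
  (oneBit_anyTrueF _).ite (oneBit_andFn (oneBit_anyTrueF _) (oneBit_anyTrueF _))
    (HashBricks.oneBit_xorFn (oneBit_baseBitF.comp _) (oneBit_anyTrueF _))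

/-- `blkF p ∈ FP`. [folklore] -/
theorem blkF_mem_FP : blkF p ∈ FP :=
  comp_mem_FP takeFn_mem_FP (fanoutFn_mem_FP (comp_mem_FP (polyFn_mem_FP _) (nthF_mem_FP 0)) (nthF_mem_FP 4))

/-- **`blockBitF ∈ FP` for `R ∈ P`.** [cite: AroraBarak2009, §1.3] -/
theorem blockBitF_mem_FP (hR : R ∈ Classes.P) : blockBitF R p ∈ FP := by
  have hblk := blkF_mem_FP (p := p)
  refine iteFn_mem_FP ?_ (andFn_mem_FP ?_ ?_) (HashBricks.xorFn_mem_FP ?_ ?_)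
  · exact anyTrueF_mem_FP (comp_mem_FP bitAtFn_mem_FP
      (fanoutFn_mem_FP (comp_mem_FP (polyFn_mem_FP _) (nthF_mem_FP 0)) hblk))
  · exact anyTrueF_mem_FP (comp_mem_FP takeFn_mem_FP (fanoutFn_mem_FP (nthF_mem_FP 2)
      (comp_mem_FP dropFn_mem_FP (fanoutFn_mem_FP (comp_mem_FP (polyFn_mem_FP _) (nthF_mem_FP 0)) hblk))))
  · exact anyTrueF_mem_FP (comp_mem_FP bitAtFn_mem_FP
      (fanoutFn_mem_FP (comp_mem_FP (polyFn_mem_FP _) (nthF_mem_FP 0)) hblk))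
  · exact comp_mem_FP (baseBitF_mem_FP hR) (fanoutFn_mem_FP (nthF_mem_FP 0)
      (comp_mem_FP takeFn_mem_FP (fanoutFn_mem_FP (comp_mem_FP (polyFn_mem_FP _) (nthF_mem_FP 0)) hblk)))
  · exact anyTrueF_mem_FP (comp_mem_FP take1Fn_mem_FP (nthF_mem_FP 3))

end Block

/-! ### One round of the loop, the loop, the whole function -/

section Loop

variable (R : Language Bool) (p : Polynomial ℕ)

/-- **One round**: `⟨1ⁱ, s :: ss, bods, acc⟩ ↦ ⟨1ⁱ⁺¹, ss, bods ⇂ B, acc ++ [bit]⟩`.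
[cite: AroraBarak2009, §1.3 (bounded loops)] -/
def roundF : List Bool → List Bool :=
  fanoutFn (fun z => [true] ++ nthF 2 z)
    (fanoutFn (List.tail ∘ nthF 3)
      (fanoutFn (dropFn ∘ fanoutFn (polyFn (bodyPoly p) ∘ nthF 0) (nthF 4))
        (fun z => sndPow 4 z ++ blockBitF R p z)))

/-- **The initial record** from the block input `u = x ++ r ++ vg |x|`: parse `x` and `r`
(`CWrap.nUF`, `CWrap.dF`), split `r` into `K` sign coins and the bodies, set the countdown to
`K = m + 2`. [folklore] -/
def initF : List Bool → List Bool :=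
  fanoutFn xF
    (fanoutFn (lenBinF ∘ polyFn (p + Polynomial.C 2) ∘ xF)
      (fanoutFn (fun _ => [])
        (fanoutFn (takeFn ∘ fanoutFn (polyFn (p + Polynomial.C 2) ∘ xF) (dropFn ∘ fanoutFn nUF dF))
          (fanoutFn (dropFn ∘ fanoutFn (polyFn (p + Polynomial.C 2) ∘ xF) (dropFn ∘ fanoutFn nUF dF))
            (fun _ => [])))))

/-- **The counting function of the quantum core** as a total string function.
[cite: Aaronson2005, Thm. 4 (proof)] -/
def phiF : List Bool → List Bool :=
  sndPow 4 ∘ (fun z => (loopStep (roundF R p))^[(p + Polynomial.C 2).eval (fstF z).length] z) ∘ initF p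

variable {R p}

/-- Value of one round on a well-formed record. [folklore] -/
theorem roundF_rec6 (x cnt : List Bool) (i : ℕ) (s : Bool) (ss bods acc : List Bool)
    (hb : bodyLen p x.length ≤ bods.length) :
    roundF R p (rec6 x cnt (ones i) (s :: ss) bods acc) =
      boolPair (ones (i + 1)) (boolPair ss (boolPair (bods.drop (bodyLen p x.length))
        (acc ++ [blockBit R p x i s (bods.take (bodyLen p x.length))]))) := by
  unfold roundF
  simp only [fanoutFn_apply, Function.comp_apply, blockBitF_apply x cnt i s ss bods acc hb]
  rw [(nthF_rec6 _ _ _ _ _ _).1, (nthF_rec6 _ _ _ _ _ _).2.2.1, (nthF_rec6 _ _ _ _ _ _).2.2.2.1,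
    (nthF_rec6 _ _ _ _ _ _).2.2.2.2.1, (nthF_rec6 _ _ _ _ _ _).2.2.2.2.2, polyFn_apply, eval_bodyPoly,
    dropFn_boolPair, List.length_replicate, List.tail_cons]
  rfl

/-- Growth of one round: `|roundF z| ≤ |sndPow 1 z| + 9` on EVERY input. [folklore] -/
theorem length_roundF_le (z : List Bool) :
    (roundF R p z).length ≤ (sndPow 1 z).length + 9 * ((fstF z).length + 1) := by
  have h1 : 2 * (nthF 2 z).length + (sndPow 2 z).length ≤ (sndPow 1 z).length :=
    length_nthF_succ_add_sndPow_succ_le 1 z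
  have h2 : 2 * (nthF 3 z).length + (sndPow 3 z).length ≤ (sndPow 2 z).length :=
    length_nthF_succ_add_sndPow_succ_le 2 z
  have h3 : 2 * (nthF 4 z).length + (sndPow 4 z).length ≤ (sndPow 3 z).length :=
    length_nthF_succ_add_sndPow_succ_le 3 z
  obtain ⟨b, hb⟩ := oneBit_blockBitF (R := R) (p := p) z
  unfold roundF
  simp only [fanoutFn_apply, Function.comp_apply, length_boolPair, List.length_append, List.length_cons,
    List.length_nil, List.length_tail, hb, dropFn_boolPair, List.length_drop]
  omega

/-- The loop is in `FP`. [cite: AroraBarak2009, §1.3 (bounded loops), §1.4.1] -/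
theorem loop_mem_FP (hR : R ∈ Classes.P) :
    (fun z => (loopStep (roundF R p))^[(p + Polynomial.C 2).eval (fstF z).length] z) ∈ FP := by
  refine loopFn_mem_FP ?_ (fun z => length_roundF_le z) _
  unfold roundF
  exact fanoutFn_mem_FP (Complexity.append_mem_FP (const_mem_FP _) (nthF_mem_FP 2))
    (fanoutFn_mem_FP (comp_mem_FP PRelSigma.tail_mem_FP (nthF_mem_FP 3))
      (fanoutFn_mem_FP (comp_mem_FP dropFn_mem_FP (fanoutFn_mem_FP (comp_mem_FP (polyFn_mem_FP _) (nthF_mem_FP 0))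
        (nthF_mem_FP 4))) (Complexity.append_mem_FP (sndPow_mem_FP 4) (blockBitF_mem_FP hR))))

/-- `initF p ∈ FP`. [folklore] -/
theorem initF_mem_FP : initF p ∈ FP := by
  have hx : xF ∈ FP := comp_mem_FP takeFn_mem_FP (fanoutFn_mem_FP nUF_mem_FP dF_mem_FP)
  have hr : (dropFn ∘ fanoutFn nUF dF) ∈ FP := comp_mem_FP dropFn_mem_FP (fanoutFn_mem_FP nUF_mem_FP dF_mem_FP)
  have hK : (polyFn (p + Polynomial.C 2) ∘ xF) ∈ FP := comp_mem_FP (polyFn_mem_FP _) hx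
  unfold initF
  exact fanoutFn_mem_FP hx (fanoutFn_mem_FP (comp_mem_FP lenBinF_mem_FP hK) (fanoutFn_mem_FP (const_mem_FP _)
    (fanoutFn_mem_FP (comp_mem_FP takeFn_mem_FP (fanoutFn_mem_FP hK hr))
      (fanoutFn_mem_FP (comp_mem_FP dropFn_mem_FP (fanoutFn_mem_FP hK hr)) (const_mem_FP _)))))

/-- **`phiF R p ∈ FP` for `R ∈ P`.** [cite: AroraBarak2009, §1.3] -/
theorem phiF_mem_FP (hR : R ∈ Classes.P) : phiF R p ∈ FP :=
  comp_mem_FP (sndPow_mem_FP 4) (comp_mem_FP (loop_mem_FP hR) initF_mem_FP)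

/-- The parsed parts of the block input `x ++ r ++ vg |x|`. [folklore] -/
theorem parse_input (x r : List Bool) :
    nUF (x ++ r ++ vg x.length) = ones x.length ∧ dF (x ++ r ++ vg x.length) = x ++ r ∧
      xF (x ++ r ++ vg x.length) = x := by
  have h := reverse_append_vg (x ++ r) x.length
  refine ⟨?_, ?_, ?_⟩
  · rw [nUF_apply, h, boolUnpair_boolPair]
  · rw [dF_apply, h, boolUnpair_boolPair]; simp
  · unfold xF
    simp only [Function.comp_apply, fanoutFn_apply]
    rw [nUF_apply, dF_apply, h, boolUnpair_boolPair, takeFn_boolPair]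
    simp

/-- Value of the initial record. [folklore] -/
theorem initF_apply (x r : List Bool) :
    initF p (x ++ r ++ vg x.length) =
      rec6 x (encodeNat (p.eval x.length + 2)) [] (r.take (p.eval x.length + 2)) (r.drop (p.eval x.length + 2)) [] := by
  obtain ⟨hn, hd, hx⟩ := parse_input x r
  unfold initF rec6
  simp only [fanoutFn_apply, Function.comp_apply, hn, hd, hx, polyFn_apply, Polynomial.eval_add, Polynomial.eval_C,
    lenBinF_apply, List.length_replicate, dropFn_boolPair, takeFn_boolPair, List.drop_left]

/-- **The loop invariant**: from index `1ⁱ`, signs `ss₁ ++ ss₂` and bodies holding at least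
`|ss₁|` bodies, `|ss₁|` rounds consume `ss₁` and those bodies and append the corresponding
computed bits. [folklore] -/
theorem loopModel_roundF (x : List Bool) : ∀ (ss₁ : List Bool) (i : ℕ) (ss₂ bods acc : List Bool),
    bodiesLen (bodyLen p x.length) ss₁.length ≤ bods.length →
    loopModel (roundF R p) x ss₁.length (boolPair (ones i) (boolPair (ss₁ ++ ss₂) (boolPair bods acc))) =
      boolPair (ones (i + ss₁.length)) (boolPair ss₂
        (boolPair (bods.drop (bodiesLen (bodyLen p x.length) ss₁.length)) (acc ++ qbits R p x i ss₁ bods)))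
  | [], i, ss₂, bods, acc, _ => by simp [loopModel, bodiesLen, qbits]
  | s :: ss₁, i, ss₂, bods, acc, hb => by
    have hB : bodyLen p x.length ≤ bods.length := by
      change bodyLen p x.length + _ ≤ _ at hb; omega
    rw [List.length_cons, loopModel, List.cons_append,
      show boolPair x (boolPair (encodeNat (ss₁.length + 1)) (boolPair (ones i) (boolPair (s :: (ss₁ ++ ss₂))
        (boolPair bods acc)))) = rec6 x (encodeNat (ss₁.length + 1)) (ones i) (s :: (ss₁ ++ ss₂)) bods acc from rfl,
      roundF_rec6 x _ i s _ bods acc hB, loopModel_roundF x ss₁ (i + 1) ss₂ _ _ (by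
        change bodyLen p x.length + _ ≤ _ at hb
        rw [List.length_drop]; omega)]
    simp only [qbits, List.append_assoc, List.singleton_append, List.drop_drop, bodiesLen,
      show i + (ss₁.length + 1) = i + 1 + ss₁.length by ring]

/-- **The defining equation of `phiF`** on well-formed block inputs: for `|r| = K + K·B`
(`K = m + 2` sign coins, then `K` bodies), `phiF (x ++ r ++ vg |x|) = qbits R p x 0 (r ↾ K) (r ⇂ K)`.
[cite: Aaronson2005, Thm. 4 (proof)] -/
theorem phiF_apply (x r : List Bool)
    (hr : r.length = (p.eval x.length + 2) + bodiesLen (bodyLen p x.length) (p.eval x.length + 2)) :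
    phiF R p (x ++ r ++ vg x.length) =
      qbits R p x 0 (r.take (p.eval x.length + 2)) (r.drop (p.eval x.length + 2)) := by
  unfold phiF
  simp only [Function.comp_apply]
  rw [initF_apply]
  have hK : (r.take (p.eval x.length + 2)).length = p.eval x.length + 2 := by
    rw [List.length_take]; omega
  unfold rec6
  rw [fstF_boolPair, Polynomial.eval_add, Polynomial.eval_C, iterate_loopStep _ _ _ _ _ le_rfl]
  have h : loopModel (roundF R p) x (r.take (p.eval x.length + 2)).length
      (boolPair [] (boolPair (r.take (p.eval x.length + 2) ++ []) (boolPair (r.drop (p.eval x.length + 2)) []))) = _ :=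
    loopModel_roundF (R := R) (p := p) x (r.take (p.eval x.length + 2)) 0 [] (r.drop (p.eval x.length + 2)) []
      (by rw [hK, List.length_drop]; omega)
  rw [List.append_nil, hK] at h
  rw [h]
  simp

/-- **The output has exactly `K` bits.** [folklore] -/
theorem length_phiF_apply (x r : List Bool)
    (hr : r.length = (p.eval x.length + 2) + bodiesLen (bodyLen p x.length) (p.eval x.length + 2)) :
    (phiF R p (x ++ r ++ vg x.length)).length = p.eval x.length + 2 := by
  rw [phiF_apply x r hr, length_qbits, List.length_take]
  omega

end Loop

end PPPostBQP

end Literature.Computability.QuantumComplexity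

end
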